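import Summits.QuantumFields.YangMills.Theorems.BalabanUVNodesN15KingModelGraphReplacementKing
import Summits.QuantumFields.YangMills.Theorems.BalabanUVNodesN15KingModelContourPhaseRate
import Literature.MathematicalPhysics.QuantumFieldTheory.King1986.MinimizerDecayUniform
import Literature.MathematicalPhysics.QuantumFieldTheory.King1986.MinimizerTwoSpacingDerivUniform

/-!
# BalabanUVNodes ∕ N15 — THE KING-MODEL RUNG (PART Η-e): PROPOSITION 3.6's REPLACEMENT STEP WITH THE EXTERNAL LINES (3.71) BY NAME — graphs whose internal
# lines carry King's `A = 0` slices and whose external lines `a_kG^η_kQ_k^*(x, y) = ℋ_k(x, y)` (and `a_k∂^η_μG^η_kQ_k^*`) run to fixed unit sites `y ∈ T^{(k)}`: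
# PROPOSITION 3.8 (3.71) as their two-spacing rate (`Prop38PrintedAt`, dag-n15-d's theorem on the Ω₁ record) and THEOREM 3.3 ∕ [Ba4] (1.10) as their size,
# mass-uniformly: `|E^{(K+n)}(H(j)) − E^{(K)}(H(j))| ≤ L^{−γK}·[Σ_ℓ 𝔼(H(j); ℓ lowered by γ) + C·Σ_υ 𝔼(H(j); υ ↦ e^{−δ₀|x − y_υ|})]`
# (Track A, DAG node N15 = NE2; FAN-OUT v1.1 §N15 s3 «KING-MODEL RUNG … NE2's analogue DECIDED in the model»)

HONEST FRAMING.  Count-neutral (cell `pub-ymgap`, seat `pub-ymgap-dag-n15-e` g25; `--supports stmt-QuantumFields-27366 --as helper` = K3⁸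
`SpineGivenEndpointR13SepCoPHV`).  TEMPLATE LITERATURE: C. King, *The U(1) Higgs model. I. The continuum limit*, Commun. Math. Phys. **102** (1986) 649–677
[King1986], proof of Proposition 3.6, p. 664 l. −6 ff., verbatim: *«First, we replace the propagators on the external lines, using the following proposition
proved in Sect. 4. When x′ ∈ T_{η′}, we denote by x that point in T_η for which x′ ∈ B^n(x). Proposition 3.8. For x′, y′ ∈ T_{η′}, 0 < α < 1, and γ sufficiently
small, |a_{k+n}G^{η′}_{k+n}Q^*_{k+n}(x′, z) − a_kG^η_kQ^*_k(x, z)|, |a_{k+n}∂^{η′}_μG^{η′}_{k+n}Q^*_{k+n}(x′, z) − a_k∂^η_μG^η_kQ^*_k(x, z)|, … ≤ CL^{−γk} exp[−δ₀{|x − z|, …}].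
(3.71)»*; p. 665: *«If we replace such a propagator in E^{(k+n)}(H), the error is the same graph with a difference or propagators on one line. Using the method
presented, this error is bounded, and Proposition 3.8 gives the desired factor L^{−γk}. All such propagators are replaced in this way.»*  King's `A = 0` MODEL
(`a_kG_kQ_k^* = ℋ_k`, (2.15) p. 653, dag-n15-d's `kingH`); NOT Bałaban's non-abelian `G(U)` of [B9]; NOT a node discharge; nothing continuum ∕ ℝ⁴ ∕ OS ∕
mass-gap ∕ Clay.  0 `sorry`; standard axioms.

WHAT THIS FILE PROVES (namespace `Summit.QuantumFields.YangMills.BalabanUVNodes.N15KingModelRung.Curved`; `T = kingTwoSpacingFull L a m² j n`, `K = j.K`).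
* §1 (`…Graph`) `graphValLS_site_update_mul` — a scalar on ONE replaced one-vertex factor comes out of the majorant graph value.
* §2 the external-line factors `kingExtLo a m² j b κ x = ℋ_K(x, b)` ∕ `∂^η_μℋ_K(x, b)` (dag-n15-d's `kingH`∕`dkingH`; `κ = none`∕`some μ`) to the unit block `b`, and
  `kingExtHi` = `ℋ_{K+n}(x′, b)` ∕ `∂^{η′}_μℋ_{K+n}(x′, b)` (read along `L^{K+n} = L^nL^K`); bridges `kingExtLo_eq_record`∕`kingExtHi_eq_record` (the record's (3.71)
  fields AT THE UNIT POINT `basePt b` ARE these factors); ★ `kingExt_sizes_unif` — THE SIZES, mass-uniformly: `∃ δₑ, cₑ > 0`, for every `0 ≤ m² ≤ m₀²`, `j`, `n`,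
  `b`, `κ`: `|kingExtLo| ≤ a·cₑ·e^{−δₑ|B(x) − b|_T}` and `|kingExtHi(x′)| ≤ a·cₑ·e^{−δₑ|B(x) − b|_T}` with `x` UNDER `x′` (the typer's mass-uniform [Ba4] (1.10) ∕
  Thm 3.3 decay `minimiser_kernel_decay_blocks_unif`, `dminimiser_kernel_decay_blocks_unif`; `blockOf_kingSlicePt`); ★ `kingExt_rate_of_prop38` — THE RATES from
  `Prop38PrintedAt α T C δ₀ γ`: `|kingExtHi(x′) − kingExtLo(x)| ≤ C·L^{−γK}·e^{−δ₀|x − y_b|∕L^K}`, `y_b = basePt b`.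
* §3 ★★★ **`king_graph_replacement_extLines`**: for odd `L ≥ 3`, `a > 0`, `m₀² ≥ 0`, `0 < α < 1` THERE ARE `C, δ₀, γ, δₑ, cₑ > 0` such that for every
  `0 < m² ≤ m₀²`, `j`, `n ≥ 1`, EVERY graph shape (internal slice lines `j_ℓ + 1 ≤ K` of kinds `κ_ℓ`; external lines `υ ∈ Υ` from the internal vertex `vtx υ` to
  the unit block `b_υ`, of kinds `κₑ_υ`):
  `|E^{(K+n)}(H(j)) − E^{(K)}(H(j))| ≤ L^{−γK}·(Σ_ℓ 𝔼^{(K)}(H(j); ℓ at the exponent lowered by γ) + C·Σ_υ 𝔼^{(K)}(H(j); υ ↦ e^{−δ₀|x − y_υ|∕L^K}))`, the majorant graph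
  `𝔼^{(K)}` carrying the (3.63)-profiles on the internal lines and `a·cₑ·e^{−δₑ|B(x) − b_υ|_T}` on the external ones — *«Proposition 3.8 gives the desired factor
  L^{−γk}»* for the external lines, Proposition 3.9 (through the lowered exponents) for the internal ones.

HONEST SCOPE.  (a) King's `A = 0` model; external lines = the two kernel members of (3.71) (`ℋ`, `∂ℋ`) to UNIT points (`IsUnit` of the record = block base
points); the Hölder members of (3.71) and the sources∕partition functions are not placed; constants per `α`, uniform in `0 < m² ≤ m₀²`, the volume `2L^m`,
`K ≥ 1`, `n ≥ 1`, the graph.  (b) The replacement step only; no power counting ((3.67)–(3.70)), no degrees.  (c) NOT Bałaban's `G(U)`; NE2 not touched; N15's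
booking unchanged; counts unmoved.  Locators: [King1986] (2.15) p.653, Thm 3.3 (3.7) p.658, Prop. 3.6 p.662, (3.63) p.663, Prop. 3.8 (3.71) p.664, p.665.
-/

noncomputable section

open scoped BigOperators
open Finset

/-! ## §1 A scalar on one replaced one-vertex factor comes out -/

namespace Summit.QuantumFields.YangMills.BalabanUVNodes.N15KingModelRung.Graph

section Scalar

variable {V S Λ Υ : Type*} [Fintype V] [DecidableEq V] [Fintype S] [Fintype Λ] [DecidableEq Λ] [Fintype Υ] [DecidableEq Υ]

/-- **a scalar on ONE replaced one-vertex factor comes out**: `𝔼(P; p[υ ↦ c·q]) = c·𝔼(P; p[υ ↦ q])`. [folklore] -/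
theorem graphValLS_site_update_mul (ω : ℝ) (src tgt : Λ → V) (P : Λ → S → S → ℝ) (vtx : Υ → V) (p : Υ → S → ℝ) (υ : Υ) (c : ℝ)
    (q : S → ℝ) :
    graphValLS ω src tgt P vtx (Function.update p υ (fun x => c * q x)) = c * graphValLS ω src tgt P vtx (Function.update p υ q) := by
  rw [graphValLS_eq_graphVal (𝕜 := ℝ), graphValLS_eq_graphVal (𝕜 := ℝ), ← update_lsFactor_inr, ← update_lsFactor_inr]
  exact graphVal_update_mul' ω _ _ c (fun σ => q (σ (vtx υ)))

end Scalar

end Summit.QuantumFields.YangMills.BalabanUVNodes.N15KingModelRung.Graph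

namespace Summit.QuantumFields.YangMills.BalabanUVNodes.N15KingModelRung.Curved

open Literature.MathematicalPhysics.QuantumFieldTheory.Balaban1983to89.B5Prop11Plancherel (Tor fine)
open Literature.MathematicalPhysics.QuantumFieldTheory.King1986 (aK aK_le)
open Literature.MathematicalPhysics.QuantumFieldTheory.King1986.Torus (tdistT tdistT_nonneg torCongr blockOf
  minimiser_kernel_decay_blocks_unif dminimiser_kernel_decay_blocks_unif)
open Literature.MathematicalPhysics.QuantumFieldTheory.King1986.SlicePropagator (Prop37PrintedAt Prop38PrintedAt Prop39PrintedAt)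
open Summit.QuantumFields.YangMills.BalabanUVNodes.N15KingModelRung (KingVolIndex kingVol kingVol_neZero basePt blockOf_basePt kingH dkingH
  kingVol_eq_sitesPerDir)
open Summit.QuantumFields.YangMills.BalabanUVNodes.N15KingModelRung.Graph

variable {d : ℕ} (L : ℕ) [NeZero L]

/-! ## §2 The external-line factors (3.71) in the model, their sizes (mass-uniform) and their rates (Prop. 3.8 by name) -/

section ExtLines

variable (a msq : ℝ) (j : KingVolIndex d)

/-- **THE COARSE EXTERNAL LINE** `a_KG^η_KQ_K^*(x, y) = ℋ_K(x, y)` (dag-n15-d's `kingH`), or its derivative `∂^η_μℋ_K(x, y)` (`dkingH`), from the fine point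
`x ∈ T_η` to the unit site `y` = the block `b`. [cite: King1986, (2.15) p.653, Prop. 3.8 (3.71) p.664] -/
def kingExtLo (b : Tor (kingVol L j)) (κ : Option (Fin (d + 1))) : Tor (fine (L ^ j.K) (kingVol L j)) → ℝ :=
  haveI := kingVol_neZero L j
  fun x => match κ with
    | none => kingH L (L ^ j.K) (kingVol L j) a msq j.K b x
    | some μ => dkingH L (L ^ j.K) (kingVol L j) a msq j.K b μ x

/-- **THE FINE EXTERNAL LINE** `a_{K+n}G^{η′}_{K+n}Q^*_{K+n}(x′, y) = ℋ_{K+n}(x′, y)` or `∂^{η′}_μℋ_{K+n}(x′, y)`, read along the spelling `L^{K+n} = L^nL^K` (as the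
record's `K′`, `dK′`). [cite: King1986, Prop. 3.8 (3.71) p.664] -/
def kingExtHi (n : ℕ) (b : Tor (kingVol L j)) (κ : Option (Fin (d + 1))) : Tor (fine (L ^ (j.K + n)) (kingVol L j)) → ℝ :=
  haveI := kingVol_neZero L j
  fun x' => match κ with
    | none => kingH L (L ^ n * L ^ j.K) (kingVol L j) a msq (j.K + n) b (torCongr (carrier_pow_add L j.K n (kingVol L j)) x')
    | some μ => dkingH L (L ^ n * L ^ j.K) (kingVol L j) a msq (j.K + n) b μ (torCongr (carrier_pow_add L j.K n (kingVol L j)) x')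

/-- bridge: the record's (3.71) fields `K`∕`dK` AT THE UNIT POINT `basePt b` are `kingExtLo`. [cite: King1986, Prop. 3.8 (3.71) p.664] -/
theorem kingExtLo_eq_record (n : ℕ) (b : Tor (kingVol L j)) (κ : Option (Fin (d + 1))) (x : Tor (fine (L ^ j.K) (kingVol L j))) :
    haveI := kingVol_neZero L j
    kingExtLo L a msq j b κ x = (match κ with
      | none => (kingTwoSpacingFull L a msq j n).K x (basePt (L ^ j.K) (kingVol L j) b)
      | some μ => (kingTwoSpacingFull L a msq j n).dK μ x (basePt (L ^ j.K) (kingVol L j) b)) := by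
  haveI := kingVol_neZero L j
  cases κ with
  | none => show _ = kingH L (L ^ j.K) (kingVol L j) a msq j.K (blockOf (L ^ j.K) (kingVol L j) (basePt (L ^ j.K) (kingVol L j) b)) x
            rw [blockOf_basePt]; rfl
  | some μ => show _ = dkingH L (L ^ j.K) (kingVol L j) a msq j.K (blockOf (L ^ j.K) (kingVol L j) (basePt (L ^ j.K) (kingVol L j) b)) μ x
              rw [blockOf_basePt]; rfl

/-- bridge: the record's `K′`∕`dK′` at `basePt b` are `kingExtHi`. [cite: King1986, Prop. 3.8 (3.71) p.664] -/
theorem kingExtHi_eq_record (n : ℕ) (b : Tor (kingVol L j)) (κ : Option (Fin (d + 1))) (x' : Tor (fine (L ^ (j.K + n)) (kingVol L j))) :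
    haveI := kingVol_neZero L j
    kingExtHi L a msq j n b κ x' = (match κ with
      | none => (kingTwoSpacingFull L a msq j n).K' x' (basePt (L ^ j.K) (kingVol L j) b)
      | some μ => (kingTwoSpacingFull L a msq j n).dK' μ x' (basePt (L ^ j.K) (kingVol L j) b)) := by
  haveI := kingVol_neZero L j
  cases κ with
  | none => show _ = kingH L (L ^ n * L ^ j.K) (kingVol L j) a msq (j.K + n) (blockOf (L ^ j.K) (kingVol L j) (basePt (L ^ j.K) (kingVol L j) b)) _
            rw [blockOf_basePt]; rfl
  | some μ => show _ = dkingH L (L ^ n * L ^ j.K) (kingVol L j) a msq (j.K + n) (blockOf (L ^ j.K) (kingVol L j) (basePt (L ^ j.K) (kingVol L j) b)) μ _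
              rw [blockOf_basePt]; rfl

variable {L a j}

/-- ★ **THE RATES OF THE EXTERNAL LINES FROM PROPOSITION 3.8 BY NAME**: `Prop38PrintedAt α T C δ₀ γ` (dag-n15-d's (3.71) on the Ω₁ record) gives, at every
unit block `b` and both kernel members, `|kingExtHi(x′) − kingExtLo(x)| ≤ C·L^{−γK}·exp[−δ₀|x − y_b|∕L^K]` (`x` under `x′`, `y_b = basePt b`).
[cite: King1986, Prop. 3.8 (3.71) p.664] -/
theorem kingExt_rate_of_prop38 {n : ℕ} {α C δ₀ γ : ℝ}
    (h38 : haveI := kingVol_neZero L j; Prop38PrintedAt α (kingTwoSpacingFull L a msq j n) C δ₀ γ)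
    (b : Tor (kingVol L j)) (κ : Option (Fin (d + 1))) (x' : haveI := kingVol_neZero L j; Tor (fine (L ^ (j.K + n)) (kingVol L j))) :
    haveI := kingVol_neZero L j
    ‖kingExtHi L a msq j n b κ x' - kingExtLo L a msq j b κ (kingSlicePt L j.K n (kingVol L j) x')‖
      ≤ C * (L : ℝ) ^ (-(γ * j.K))
        * Real.exp (-(δ₀ * (tdistT (fine (L ^ j.K) (kingVol L j)) (kingSlicePt L j.K n (kingVol L j) x') (basePt (L ^ j.K) (kingVol L j) b)
          / (L : ℝ) ^ j.K))) := by
  haveI := kingVol_neZero L j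
  have hz : (kingTwoSpacingFull L a msq j n).IsUnit (basePt (L ^ j.K) (kingVol L j) b) := by
    show basePt (L ^ j.K) (kingVol L j) b = basePt (L ^ j.K) (kingVol L j) (blockOf (L ^ j.K) (kingVol L j) (basePt (L ^ j.K) (kingVol L j) b))
    rw [blockOf_basePt]
  obtain ⟨h1, h2⟩ := h38.1 x' (basePt (L ^ j.K) (kingVol L j) b) hz
  rw [Real.norm_eq_abs, kingExtHi_eq_record L a msq j n, kingExtLo_eq_record L a msq j n]
  rcases κ with _ | μ
  · exact h1
  · exact h2 μ

/-- ★ **THE SIZES OF THE EXTERNAL LINES, MASS-UNIFORMLY, READ THROUGH THE PAIRING** (Theorem 3.3 (3.7) ∕ [Ba4] (1.10) for `ℋ_K` — the typer's mass-uniform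
`minimiser_kernel_decay_blocks_unif` ∕ `dminimiser_kernel_decay_blocks_unif`, `a_K ≤ a`): `∃ δₑ, cₑ > 0` with, for EVERY `0 ≤ m² ≤ m₀²`, index `j`, `n`, unit block
`b`, kind `κ`: `|kingExtLo(x)| ≤ a·cₑ·e^{−δₑ|B(x) − b|_T}` and `|kingExtHi(x′)| ≤ a·cₑ·e^{−δₑ|B(x) − b|_T}` with `x` UNDER `x′` (`B(x′) = B(x)`, Κ-b `blockOf_kingSlicePt`) —
both lattices in coarse currency, no pairing defect. [cite: King1986, Theorem 3.3 (3.7) p.658, (3.64) p.663; Balaban1983RegularityDecay, Theorem (1.10) p.573] -/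
theorem kingExt_sizes_unif (hLodd : Odd L) (hL : 2 ≤ L) (ha : 0 < a) {m0sq : ℝ} (hm0 : 0 ≤ m0sq) :
    ∃ δe ce : ℝ, 0 < δe ∧ 0 < ce ∧ ∀ (msq : ℝ), 0 ≤ msq → msq ≤ m0sq → ∀ (j : KingVolIndex d) (n : ℕ) (b : Tor (kingVol L j))
      (κ : Option (Fin (d + 1))),
      haveI := kingVol_neZero L j
      (∀ x : Tor (fine (L ^ j.K) (kingVol L j)),
        ‖kingExtLo L a msq j b κ x‖ ≤ a * ce * Real.exp (-(δe * tdistT (kingVol L j) (blockOf (L ^ j.K) (kingVol L j) x) b))) ∧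
      (∀ x' : Tor (fine (L ^ (j.K + n)) (kingVol L j)),
        ‖kingExtHi L a msq j n b κ x'‖
          ≤ a * ce * Real.exp (-(δe * tdistT (kingVol L j) (blockOf (L ^ j.K) (kingVol L j) (kingSlicePt L j.K n (kingVol L j) x')) b))) := by
  have hL1 : 1 < L := by omega
  have hLr : (1 : ℝ) < L := by exact_mod_cast hL1
  obtain ⟨δ₁, c₁, hδ₁, hc₁, H₁⟩ := minimiser_kernel_decay_blocks_unif (d + 1) L (Nat.succ_pos d) ⟨hLodd, hL1⟩ ha hm0
  obtain ⟨δ₂, c₂, hδ₂, hc₂, H₂⟩ := dminimiser_kernel_decay_blocks_unif (d + 1) L (Nat.succ_pos d) ⟨hLodd, hL1⟩ ha hm0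
  refine ⟨min δ₁ δ₂, c₁ + c₂, lt_min hδ₁ hδ₂, by positivity, fun msq hm hcap j n b κ => ?_⟩
  haveI := kingVol_neZero L j
  -- the index of the fine run: same volume, `K + n` scales
  let j' : KingVolIndex d := ⟨j.m, j.K + n, by have := j.one_le_K; omega, j.Msz, j.one_le_Msz⟩
  have hpow : L ^ (j.K + n) = L ^ n * L ^ j.K := by rw [pow_add, Nat.mul_comm]
  -- weakening of the two mass-uniform profiles to the common one
  have hweak : ∀ {t : ℝ} (_ : 0 ≤ t) (K : ℕ) (_ : 1 ≤ K) (c δ : ℝ) (_ : c = c₁ ∧ δ = δ₁ ∨ c = c₂ ∧ δ = δ₂) {v : ℝ},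
      |v| ≤ aK a L K * c * Real.exp (-(δ * t)) → ‖v‖ ≤ a * (c₁ + c₂) * Real.exp (-(min δ₁ δ₂ * t)) := by
    intro t ht K hK c δ hcd v hv
    rw [Real.norm_eq_abs]
    have hc : 0 ≤ c ∧ c ≤ c₁ + c₂ ∧ min δ₁ δ₂ ≤ δ := by
      rcases hcd with ⟨rfl, rfl⟩ | ⟨rfl, rfl⟩
      · exact ⟨hc₁.le, by linarith, min_le_left _ _⟩
      · exact ⟨hc₂.le, by linarith, min_le_right _ _⟩
    refine hv.trans ?_
    have hexp : Real.exp (-(δ * t)) ≤ Real.exp (-(min δ₁ δ₂ * t)) := Real.exp_le_exp.2 (by nlinarith [hc.2.2])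
    calc aK a L K * c * Real.exp (-(δ * t)) ≤ a * (c₁ + c₂) * Real.exp (-(δ * t)) :=
          mul_le_mul_of_nonneg_right (mul_le_mul (aK_le ha hLr hK) hc.2.1 hc.1 ha.le) (Real.exp_nonneg _)
      _ ≤ a * (c₁ + c₂) * Real.exp (-(min δ₁ δ₂ * t)) := mul_le_mul_of_nonneg_left hexp (by positivity)
  refine ⟨fun x => ?_, fun x' => ?_⟩
  · rcases κ with _ | μ
    · exact hweak (tdistT_nonneg _ _ _) j.K j.one_le_K c₁ δ₁ (Or.inl ⟨rfl, rfl⟩)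
        (H₁ (j.params L hLodd hL) rfl rfl j.one_le_K msq hm hcap (kingVol L j) (kingVol_eq_sitesPerDir L hLodd hL j) (L ^ j.K) rfl x b)
    · exact hweak (tdistT_nonneg _ _ _) j.K j.one_le_K c₂ δ₂ (Or.inr ⟨rfl, rfl⟩)
        (H₂ (j.params L hLodd hL) rfl rfl j.one_le_K msq hm hcap (kingVol L j) (kingVol_eq_sitesPerDir L hLodd hL j) (L ^ j.K) rfl x b μ)
  · have hblk : blockOf (L ^ j.K) (kingVol L j) (kingSlicePt L j.K n (kingVol L j) x') = blockOf (L ^ (j.K + n)) (kingVol L j) x' :=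
      blockOf_kingSlicePt L j.K n (kingVol L j) x'
    rw [hblk]
    rcases κ with _ | μ
    · have hc : kingExtHi L a msq j n b none x' = kingH L (L ^ (j.K + n)) (kingVol L j) a msq (j.K + n) b x' :=
        kingH_congrN L hpow (kingVol L j) (carrier_pow_add L j.K n (kingVol L j)) a msq (j.K + n) b x'
      rw [hc]
      exact hweak (tdistT_nonneg _ _ _) (j.K + n) (by have := j.one_le_K; omega) c₁ δ₁ (Or.inl ⟨rfl, rfl⟩)
        (H₁ (j'.params L hLodd hL) rfl rfl j'.one_le_K msq hm hcap (kingVol L j) (kingVol_eq_sitesPerDir L hLodd hL j') (L ^ (j.K + n)) rfl x' b)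
    · have hc : kingExtHi L a msq j n b (some μ) x' = dkingH L (L ^ (j.K + n)) (kingVol L j) a msq (j.K + n) b μ x' :=
        dkingH_congrN L hpow (kingVol L j) (carrier_pow_add L j.K n (kingVol L j)) a msq (j.K + n) b μ x'
      rw [hc]
      exact hweak (tdistT_nonneg _ _ _) (j.K + n) (by have := j.one_le_K; omega) c₂ δ₂ (Or.inr ⟨rfl, rfl⟩)
        (H₂ (j'.params L hLodd hL) rfl rfl j'.one_le_K msq hm hcap (kingVol L j) (kingVol_eq_sitesPerDir L hLodd hL j') (L ^ (j.K + n)) rfl x' b μ)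

end ExtLines

/-! ## §3 The replacement step with internal slices AND external lines, BY NAME at `A = 0` -/

section ByName

/-- ★★★ **PROPOSITION 3.6's REPLACEMENT STEP WITH THE EXTERNAL LINES (3.71) BY NAME AT `A = 0`.**  For odd `L ≥ 3`, `a > 0`, `m₀² ≥ 0`, `0 < α < 1` there are
`C, δ₀, γ, δₑ, cₑ > 0` such that for every `0 < m² ≤ m₀²`, every `j` (`K = j.K`), every `n ≥ 1` and EVERY graph shape — internal vertices `V` (weights
`η^{d+1}`, `η′^{d+1}`), internal lines `ℓ` carrying the slices `j_ℓ` (`j_ℓ + 1 ≤ K`, kinds `κ_ℓ`) of King's `A = 0` propagator, EXTERNAL LINES `υ ∈ Υ` from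
`vtx υ` to the unit block `b_υ` carrying `ℋ_K(x, y_υ)` or `∂^η_μℋ_K(x, y_υ)` (kinds `κₑ_υ`; fine: `ℋ_{K+n}(x′, y_υ)` …) —
`|E^{(K+n)}(H(j)) − E^{(K)}(H(j))| ≤ L^{−γK}·(Σ_ℓ 𝔼^{(K)}(H(j); ℓ at the exponent lowered by γ) + C·Σ_υ 𝔼^{(K)}(H(j); υ ↦ e^{−δ₀|x − y_υ|∕L^K}))`, the majorant graph
with the (3.63)-profiles on the internal lines and `a·cₑ·e^{−δₑ|B(x) − b_υ|_T}` on the external ones.  ASSEMBLY: Ω₂ `king_props37_38_39_commonConstants`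
(Props. 3.7∕3.8∕3.9, ONE triple) + Η-c (fibres, weights, fine slice sizes) + §2 + part Η-b `graph_replacement_twoSpacing`; the factor `L^{−γK}` comes out of
BOTH sums (*«Proposition 3.8 gives the desired factor L^{−γk}»*). [cite: King1986, pp.664–665 (proof of Prop. 3.6), Prop. 3.8 (3.71) p.664, (3.63) p.663, (3.73) p.665] -/
theorem king_graph_replacement_extLines (hLodd : Odd L) (hL : 2 ≤ L) {a : ℝ} (ha : 0 < a) {m0sq : ℝ} (hm0 : 0 ≤ m0sq)
    {α : ℝ} (hα0 : 0 < α) (hα1 : α < 1) :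
    ∃ C δ₀ γ δe ce : ℝ, 0 < C ∧ 0 < δ₀ ∧ 0 < γ ∧ 0 < δe ∧ 0 < ce ∧
      ∀ (msq : ℝ), 0 < msq → msq ≤ m0sq → ∀ (j : KingVolIndex d) (n : ℕ), 1 ≤ n →
      ∀ (V Λ Υ : Type) [Fintype V] [DecidableEq V] [Fintype Λ] [DecidableEq Λ] [Fintype Υ] [DecidableEq Υ]
        (src tgt : Λ → V) (js : Λ → ℕ), (∀ ℓ, js ℓ + 1 ≤ j.K) → ∀ (κ : Λ → Option (Fin (d + 1))) (vtx : Υ → V)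
        (b : Υ → Tor (kingVol L j)) (κe : Υ → Option (Fin (d + 1))),
        haveI := kingVol_neZero L j
        ‖graphValLS ((((L : ℝ) ^ (j.K + n))⁻¹) ^ (d + 1)) src tgt (fun ℓ => kingHiLine L a msq j n (js ℓ) (κ ℓ)) vtx
              (fun υ => kingExtHi L a msq j n (b υ) (κe υ))
            - graphValLS ((((L : ℝ) ^ j.K)⁻¹) ^ (d + 1)) src tgt (fun ℓ => kingLoLine L a msq j n (js ℓ) (κ ℓ)) vtx
              (fun υ => kingExtLo L a msq j (b υ) (κe υ))‖
          ≤ (L : ℝ) ^ (-(γ * j.K)) *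
              (∑ ℓ, graphValLS ((((L : ℝ) ^ j.K)⁻¹) ^ (d + 1)) src tgt
                  (Function.update (fun ℓ => kingSizeProfile L a msq j n C δ₀ (js ℓ) (κ ℓ)) ℓ (kingReducedProfile L a msq j n C δ₀ γ (js ℓ) (κ ℓ))) vtx
                  (fun υ x => a * ce * Real.exp (-(δe * tdistT (kingVol L j) (blockOf (L ^ j.K) (kingVol L j) x) (b υ))))
              + C * ∑ υ, graphValLS ((((L : ℝ) ^ j.K)⁻¹) ^ (d + 1)) src tgt (fun ℓ => kingSizeProfile L a msq j n C δ₀ (js ℓ) (κ ℓ)) vtx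
                  (Function.update (fun υ x => a * ce * Real.exp (-(δe * tdistT (kingVol L j) (blockOf (L ^ j.K) (kingVol L j) x) (b υ)))) υ
                    (fun x => Real.exp (-(δ₀ * (tdistT (fine (L ^ j.K) (kingVol L j)) x (basePt (L ^ j.K) (kingVol L j) (b υ)) / (L : ℝ) ^ j.K)))))) := by
  obtain ⟨C, δ₀, γ, hC, hδ₀, hγ, H⟩ := king_props37_38_39_commonConstants (d := d) L hLodd hL ha hm0 hα0 hα1
  obtain ⟨δe, ce, hδe, hce, He⟩ := kingExt_sizes_unif (d := d) (L := L) (a := a) hLodd hL ha hm0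
  have hL1 : 1 ≤ L := by omega
  have hL0 : (0 : ℝ) < L := by exact_mod_cast (show 0 < L by omega)
  refine ⟨C * Real.exp δ₀, δ₀, γ, δe, ce, by positivity, hδ₀, hγ, hδe, hce,
    fun msq hm hcap j n hn V Λ Υ _ _ _ _ _ _ src tgt js hjs κ vtx b κe => ?_⟩
  haveI := kingVol_neZero L j
  obtain ⟨h37, h37', h38, h39⟩ := H msq hm hcap j n hn
  letI : Fintype (kingTwoSpacingFull L a msq j n).lo.S := inferInstanceAs (Fintype (Tor (fine (L ^ j.K) (kingVol L j))))
  letI : DecidableEq (kingTwoSpacingFull L a msq j n).lo.S := inferInstanceAs (DecidableEq (Tor (fine (L ^ j.K) (kingVol L j))))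
  letI : Fintype (kingTwoSpacingFull L a msq j n).hi.S := inferInstanceAs (Fintype (Tor (fine (L ^ (j.K + n)) (kingVol L j))))
  have hCe : C ≤ C * Real.exp δ₀ := le_mul_of_one_le_right hC.le (Real.one_le_exp hδ₀.le)
  have h37e : Prop37PrintedAt α (kingTwoSpacingFull L a msq j n).lo (C * Real.exp δ₀) δ₀ :=
    prop37PrintedAt_mono (D := (kingTwoSpacingFull L a msq j n).lo) hL1 (kingTwoSpacingFull_lodist_nonneg L a msq j n)
      (fun _ _ b => nomatch b) hC.le hCe le_rfl h37
  have h38e : Prop38PrintedAt α (kingTwoSpacingFull L a msq j n) (C * Real.exp δ₀) δ₀ γ :=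
    prop38PrintedAt_mono (T := kingTwoSpacingFull L a msq j n) hL1 (kingTwoSpacingFull_lodist_nonneg L a msq j n) hC.le hCe le_rfl le_rfl h38
  have h39e : Prop39PrintedAt α (kingTwoSpacingFull L a msq j n) (C * Real.exp δ₀) δ₀ γ :=
    prop39PrintedAt_mono (T := kingTwoSpacingFull L a msq j n) hL1 (kingTwoSpacingFull_lodist_nonneg L a msq j n)
      (fun _ _ b => nomatch b) hC.le hCe le_rfl le_rfl h39
  have hhi : ∀ jl : ℕ, jl + 1 ≤ (kingTwoSpacingFull L a msq j n).lo.k →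
      ∀ (κ : Option (Fin (d + 1))) (x' y' : (kingTwoSpacingFull L a msq j n).hi.S),
      ‖hiLine (kingTwoSpacingFull L a msq j n) jl κ x' y'‖
        ≤ sizeProfile (kingTwoSpacingFull L a msq j n) (C * Real.exp δ₀) δ₀ jl κ
          ((kingTwoSpacingFull L a msq j n).pt x') ((kingTwoSpacingFull L a msq j n).pt y') :=
    fun jl hjl κ x' y' => hiLine_kingTwoSpacingFull_le L hL a msq j n hC.le hδ₀.le h37' hjl κ x' y'
  have hfib : ∀ x : (kingTwoSpacingFull L a msq j n).lo.S,
      (univ.filter fun x' : (kingTwoSpacingFull L a msq j n).hi.S => (kingTwoSpacingFull L a msq j n).pt x' = x).card = (L ^ n) ^ (d + 1) :=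
    fun x => card_filter_kingSlicePt L j.K n (kingVol L j) x
  have hw := king_weight_repair (d := d) L hL0 j.K n
  obtain ⟨hpe, hpe'⟩ : (∀ υ (x : Tor (fine (L ^ j.K) (kingVol L j))), ‖kingExtLo L a msq j (b υ) (κe υ) x‖
        ≤ a * ce * Real.exp (-(δe * tdistT (kingVol L j) (blockOf (L ^ j.K) (kingVol L j) x) (b υ)))) ∧
      (∀ υ (x' : Tor (fine (L ^ (j.K + n)) (kingVol L j))), ‖kingExtHi L a msq j n (b υ) (κe υ) x'‖
        ≤ a * ce * Real.exp (-(δe * tdistT (kingVol L j) (blockOf (L ^ j.K) (kingVol L j) (kingSlicePt L j.K n (kingVol L j) x')) (b υ)))) :=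
    ⟨fun υ x => (He msq hm.le hcap j n (b υ) (κe υ)).1 x, fun υ x' => (He msq hm.le hcap j n (b υ) (κe υ)).2 x'⟩
  have hq : ∀ υ (x' : Tor (fine (L ^ (j.K + n)) (kingVol L j))),
      ‖kingExtHi L a msq j n (b υ) (κe υ) x' - kingExtLo L a msq j (b υ) (κe υ) (kingSlicePt L j.K n (kingVol L j) x')‖
        ≤ (C * Real.exp δ₀) * (L : ℝ) ^ (-(γ * j.K))
          * Real.exp (-(δ₀ * (tdistT (fine (L ^ j.K) (kingVol L j)) (kingSlicePt L j.K n (kingVol L j) x') (basePt (L ^ j.K) (kingVol L j) (b υ))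
            / (L : ℝ) ^ j.K))) :=
    fun υ x' => kingExt_rate_of_prop38 (msq := msq) h38e (b υ) (κe υ) x'
  have h := graph_replacement_twoSpacing (kingTwoSpacingFull L a msq j n) h37e hhi h39e hfib hw src tgt js hjs κ vtx
    (fun υ => kingExtLo L a msq j (b υ) (κe υ)) (fun υ => kingExtHi L a msq j n (b υ) (κe υ))
    (fun υ x => a * ce * Real.exp (-(δe * tdistT (kingVol L j) (blockOf (L ^ j.K) (kingVol L j) x) (b υ))))
    (fun υ x => (C * Real.exp δ₀) * (L : ℝ) ^ (-(γ * j.K))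
      * Real.exp (-(δ₀ * (tdistT (fine (L ^ j.K) (kingVol L j)) x (basePt (L ^ j.K) (kingVol L j) (b υ)) / (L : ℝ) ^ j.K))))
    hpe hpe' hq
  have hnorm : ‖(((L : ℝ) ^ j.K)⁻¹) ^ (d + 1)‖ = (((L : ℝ) ^ j.K)⁻¹) ^ (d + 1) := Real.norm_of_nonneg (by positivity)
  rw [hnorm] at h
  refine h.trans (le_of_eq ?_)
  rw [mul_add, mul_sum, ← mul_assoc, mul_comm ((L : ℝ) ^ (-(γ * j.K))) (C * Real.exp δ₀), mul_sum]
  congr 1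
  · refine sum_congr rfl fun ℓ _ => ?_
    have hr : rateProfile (kingTwoSpacingFull L a msq j n) (C * Real.exp δ₀) δ₀ γ (js ℓ) (κ ℓ)
        = fun x y => (L : ℝ) ^ (-(γ * j.K)) * reducedProfile (kingTwoSpacingFull L a msq j n) (C * Real.exp δ₀) δ₀ γ (js ℓ) (κ ℓ) x y :=
      funext fun x => funext fun y => rateProfile_eq (kingTwoSpacingFull L a msq j n) (C * Real.exp δ₀) δ₀ γ (js ℓ) (κ ℓ) x y
    show graphValLS _ src tgt (Function.update (fun ℓ => sizeProfile (kingTwoSpacingFull L a msq j n) (C * Real.exp δ₀) δ₀ (js ℓ) (κ ℓ)) ℓ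
        (rateProfile (kingTwoSpacingFull L a msq j n) (C * Real.exp δ₀) δ₀ γ (js ℓ) (κ ℓ))) vtx _ = _
    rw [hr, graphValLS_line_update_mul]
    rfl
  · refine sum_congr rfl fun υ _ => ?_
    rw [graphValLS_site_update_mul]
    rfl

end ByName

end Summit.QuantumFields.YangMills.BalabanUVNodes.N15KingModelRung.Curved

end
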